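import Literature.NumberTheory.LFunctions.WeilCombNodeWeightsNode
import Literature.NumberTheory.LFunctions.WeilCombDifferenceSums
import HarnessLib

/-!
# Node weights of `ζ`-mollified combs, VII: the node sum of one pair against a Chebyshev weight

Topic `Literature/NumberTheory/LFunctions`.  Summing the node evaluation of
`Literature/NumberTheory/LFunctions/WeilCombNodeWeightsNode.lean` against a weight `f ≥ 0` with
Chebyshev bound `∑_{n ≤ N} f(n) ≤ A N`:

* `sum_div_le_of_chebyshev` — `∑_{n ≤ N} f(n)/n ≤ A (1 + log N)` (Abel summation);
* `weighted_node_pair` —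
  `|∑_{n ≤ N} f(n) V_{ℓℓ'}(n) - B(0)(√ℓ/√ℓ') ∑_n f(n) D(n)/n - h β_h (√ℓ'/√ℓ) ∑_n f(n) N(n)|`
  `≤ (8C₂L + 64N₀L²) A (1 + log N) + 8 N₀ L h A N`:
  the error of the node evaluation is one logarithm below the diagonal main term, using only the
  Chebyshev bound for `f` (this is what makes the evaluation usable for an unknown nonnegative
  weight `f = c` as well as for `f = Λ`).

Everything is proved; no named facts.
-/

noncomputable section

open MeasureTheory Set

namespace Literature.NumberTheory.LFunctions

/-! ## Harmonic sums against a Chebyshev weight -/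

/-- **Abel summation against a Chebyshev weight**: if `∑_{n ≤ N} f(n) ≤ A N` for all `N ≥ 1` and
`f ≥ 0`, then `∑_{n ≤ N} f(n)/n ≤ A (1 + log N)` for `N ≥ 1`. [folklore] -/
theorem sum_div_le_of_chebyshev {f : ℕ → ℝ} {A : ℝ} (hf0 : ∀ n, 0 ≤ f n)
    (hA : ∀ N : ℕ, 1 ≤ N → ∑ n ∈ Finset.Icc 1 N, f n ≤ A * N) {N : ℕ} (hN : 1 ≤ N) :
    ∑ n ∈ Finset.Icc 1 N, f n / n ≤ A * (1 + Real.log N) := by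
  have hA0 : 0 ≤ A := by
    have := hA 1 le_rfl
    simp only [Finset.Icc_self, Finset.sum_singleton, Nat.cast_one, mul_one] at this
    exact (hf0 1).trans this
  -- inductive claim
  have key : ∀ N : ℕ, 1 ≤ N → ∑ n ∈ Finset.Icc 1 N, f n / n
      ≤ (∑ n ∈ Finset.Icc 1 N, f n) / N + A * (∑ i ∈ Finset.Icc 1 N, (1 : ℝ) / i - 1) := by
    intro N hN
    induction N, hN using Nat.le_induction with
    | base => simp
    | succ N hN ih =>
      have hNR : (1 : ℝ) ≤ N := by exact_mod_cast hN
      have hN0 : (0 : ℝ) < N := by linarith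
      have hN1 : (0 : ℝ) < N + 1 := by linarith
      rw [Finset.sum_Icc_succ_top (by omega), Finset.sum_Icc_succ_top (by omega),
        Finset.sum_Icc_succ_top (by omega)]
      set F : ℝ := ∑ n ∈ Finset.Icc 1 N, f n with hF
      set H : ℝ := ∑ i ∈ Finset.Icc 1 N, (1 : ℝ) / i with hH
      have hFA : F ≤ A * N := hA N hN
      push_cast
      -- `F/N - F/(N+1) ≤ A/(N+1)`
      have hstep : F / N + f (N + 1) / (N + 1) ≤ (F + f (N + 1)) / (N + 1) + A * (1 / (N + 1)) := by
        rw [add_div]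
        have : F / N - F / (N + 1) ≤ A * (1 / (N + 1)) := by
          rw [div_sub_div _ _ hN0.ne' hN1.ne', show F * (N + 1) - N * F = F by ring,
            div_le_iff₀ (by positivity)]
          calc F ≤ A * N := hFA
            _ = A * (1 / (N + 1)) * (N * (N + 1)) := by field_simp
        linarith
      linarith
  have h1 := key N hN
  have hNR : (1 : ℝ) ≤ N := by exact_mod_cast hN
  have h2 : (∑ n ∈ Finset.Icc 1 N, f n) / N ≤ A := by
    rw [div_le_iff₀ (by linarith)]; exact hA N hN
  have h3 : ∑ i ∈ Finset.Icc 1 N, (1 : ℝ) / i - 1 ≤ Real.log N := by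
    linarith [LevinsonSums.sum_Icc_one_div_le N]
  have h4 := mul_le_mul_of_nonneg_left h3 hA0
  linarith

/-- The error weight `C/n + C'h` against a Chebyshev weight:
`∑_{n ≤ N} f(n)(C/n + C'h) ≤ C A (1 + log N) + C' h A N`. [folklore] -/
theorem sum_mul_error_le {f : ℕ → ℝ} {A C C' h : ℝ} (hf0 : ∀ n, 0 ≤ f n)
    (hA : ∀ N : ℕ, 1 ≤ N → ∑ n ∈ Finset.Icc 1 N, f n ≤ A * N) (hC : 0 ≤ C) (hC' : 0 ≤ C')
    (hh : 0 ≤ h) {N : ℕ} (hN : 1 ≤ N) :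
    ∑ n ∈ Finset.Icc 1 N, f n * (C / n + C' * h) ≤ C * (A * (1 + Real.log N)) + C' * h * (A * N) := by
  have e : ∑ n ∈ Finset.Icc 1 N, f n * (C / n + C' * h)
      = C * ∑ n ∈ Finset.Icc 1 N, f n / n + C' * h * ∑ n ∈ Finset.Icc 1 N, f n := by
    rw [Finset.mul_sum, Finset.mul_sum, ← Finset.sum_add_distrib]
    refine Finset.sum_congr rfl fun n _ ↦ by ring
  rw [e]
  exact add_le_add (mul_le_mul_of_nonneg_left (sum_div_le_of_chebyshev hf0 hA hN) hC)
    (mul_le_mul_of_nonneg_left (hA N hN) (by positivity))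

/-! ## The node sum of one pair -/

/-- **Node sum of one pair `(ℓ, ℓ')` against a Chebyshev weight.** Under the hypotheses of
`node_weight_pair`, for `f ≥ 0` with `∑_{n ≤ N} f(n) ≤ AN` (`N ≥ 1`):
`|∑_{n ≤ N} f(n) V(n) - B(0)(√ℓ/√ℓ') ∑_{n ≤ N} f(n) D(n)/n - hβ_h(√ℓ'/√ℓ) ∑_{n ≤ N} f(n) N(n)|`
`≤ (8C₂L + 64N₀L²) A (1 + log N) + 8N₀L h A N`. [folklore] -/
theorem weighted_node_pair {B B' B'' : ℝ → ℝ} {N₀ N₁ N₂ h A : ℝ} {L ℓ ℓ' M N : ℕ} {f : ℕ → ℝ}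
    (hB : ∀ x, HasDerivAt B (B' x) x) (hB' : ∀ x, HasDerivAt B' (B'' x) x)
    (h0 : ∀ x, |B x| ≤ N₀) (h1 : ∀ x, |B' x| ≤ N₁) (h2 : ∀ x, |B'' x| ≤ N₂)
    (hBs : ∀ x, 2 < |x| → B x = 0) (hB0 : ∀ x, 0 ≤ B x)
    (hL : 1 ≤ L) (hℓ : 1 ≤ ℓ) (hℓL : ℓ ≤ L) (hℓ' : 1 ≤ ℓ') (hℓ'L : ℓ' ≤ L)
    (hh : 0 < h) (hhL : h ≤ 1 / (32 * L)) (hhM : 1 ≤ h * M) (hhM2 : h ^ 2 * M ≤ 1)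
    (hf0 : ∀ n, 0 ≤ f n) (hA : ∀ N : ℕ, 1 ≤ N → ∑ n ∈ Finset.Icc 1 N, f n ≤ A * N) (hN : 1 ≤ N) :
    |∑ n ∈ Finset.Icc 1 N, f n *
        (∑ k' ∈ Finset.Icc 1 M,
          (∑ k ∈ Finset.Icc 1 M, B ((Real.log ((n : ℝ) * ℓ' * k' / ℓ) - Real.log k) / h) / Real.sqrt k)
            / Real.sqrt k' / Real.sqrt n)
      - B 0 * (Real.sqrt ℓ / Real.sqrt ℓ') * ∑ n ∈ Finset.Icc 1 N,
          f n * (∑ k' ∈ Finset.Icc 1 ⌊1 / (4 * h) / ((n : ℝ) * ℓ')⌋₊,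
            (if ℓ ∣ n * ℓ' * k' then 1 / (k' : ℝ) else 0)) / n
      - h * (∫ v, B v * Real.exp (-(h * v) / 2)) * (Real.sqrt ℓ' / Real.sqrt ℓ) *
          ∑ n ∈ Finset.Icc 1 N, f n *
            ((min M ⌊(ℓ : ℝ) * M * Real.exp (-(2 * h)) / (ℓ' * n)⌋₊
                - ⌊1 / (4 * h) / ((n : ℝ) * ℓ')⌋₊ : ℕ) : ℝ)|
      ≤ (8 * ((N₀ + 2 * N₁ + N₂) * (96 + 192 * L) * L ^ 2) * L + 64 * N₀ * L ^ 2) *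
          (A * (1 + Real.log N)) + 8 * N₀ * L * h * (A * N) := by
  have hN₀ : 0 ≤ N₀ := (abs_nonneg _).trans (h0 0)
  have hN₁ : 0 ≤ N₁ := (abs_nonneg _).trans (h1 0)
  have hN₂ : 0 ≤ N₂ := (abs_nonneg _).trans (h2 0)
  set V : ℕ → ℝ := fun n ↦ ∑ k' ∈ Finset.Icc 1 M,
    (∑ k ∈ Finset.Icc 1 M, B ((Real.log ((n : ℝ) * ℓ' * k' / ℓ) - Real.log k) / h) / Real.sqrt k)
      / Real.sqrt k' / Real.sqrt n with hV
  set D : ℕ → ℝ := fun n ↦ ∑ k' ∈ Finset.Icc 1 ⌊1 / (4 * h) / ((n : ℝ) * ℓ')⌋₊,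
    (if ℓ ∣ n * ℓ' * k' then 1 / (k' : ℝ) else 0) with hD
  set Nn : ℕ → ℝ := fun n ↦ ((min M ⌊(ℓ : ℝ) * M * Real.exp (-(2 * h)) / (ℓ' * n)⌋₊
    - ⌊1 / (4 * h) / ((n : ℝ) * ℓ')⌋₊ : ℕ) : ℝ) with hNn
  set mS : ℝ := B 0 * (Real.sqrt ℓ / Real.sqrt ℓ') with hmS
  set mD : ℝ := h * (∫ v, B v * Real.exp (-(h * v) / 2)) * (Real.sqrt ℓ' / Real.sqrt ℓ) with hmD
  set Cst : ℝ := 8 * ((N₀ + 2 * N₁ + N₂) * (96 + 192 * L) * L ^ 2) * L + 64 * N₀ * L ^ 2 with hCst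
  have hCst0 : 0 ≤ Cst := by positivity
  -- pointwise error
  have hpt : ∀ n ∈ Finset.Icc 1 N, |V n - mS * D n / n - mD * Nn n| ≤ Cst / n + 8 * N₀ * L * h := by
    intro n hn
    have hn1 : 1 ≤ n := (Finset.mem_Icc.1 hn).1
    exact node_weight_pair hB hB' h0 h1 h2 hBs hB0 hL hℓ hℓL hℓ' hℓ'L hn1 hh hhL hhM hhM2
  -- the difference as one sum
  have hsum : ∑ n ∈ Finset.Icc 1 N, f n * V n - mS * ∑ n ∈ Finset.Icc 1 N, f n * D n / n
      - mD * ∑ n ∈ Finset.Icc 1 N, f n * Nn n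
      = ∑ n ∈ Finset.Icc 1 N, f n * (V n - mS * D n / n - mD * Nn n) := by
    rw [Finset.mul_sum, Finset.mul_sum, ← Finset.sum_sub_distrib, ← Finset.sum_sub_distrib]
    refine Finset.sum_congr rfl fun n _ ↦ by ring
  rw [hsum]
  calc |∑ n ∈ Finset.Icc 1 N, f n * (V n - mS * D n / n - mD * Nn n)|
      ≤ ∑ n ∈ Finset.Icc 1 N, |f n * (V n - mS * D n / n - mD * Nn n)| := Finset.abs_sum_le_sum_abs _ _
    _ ≤ ∑ n ∈ Finset.Icc 1 N, f n * (Cst / n + 8 * N₀ * L * h) := by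
        refine Finset.sum_le_sum fun n hn ↦ ?_
        rw [abs_mul, abs_of_nonneg (hf0 n)]
        exact mul_le_mul_of_nonneg_left (hpt n hn) (hf0 n)
    _ ≤ Cst * (A * (1 + Real.log N)) + 8 * N₀ * L * h * (A * N) :=
        sum_mul_error_le hf0 hA hCst0 (by positivity) hh.le hN

end Literature.NumberTheory.LFunctions
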